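import Summits.BirchSwinnertonDyer.Rank1Residual.Additive.GordCycLowerBoundClass
import Summits.BirchSwinnertonDyer.Rank1Residual.Additive.ChiBranchLowerInput
import Summits.BirchSwinnertonDyer.Rank1Residual.Additive.ChiBranchConstantTerm
import Summits.BirchSwinnertonDyer.Rank1Residual.Additive.SemistableTwistAnalytic
import Summits.BirchSwinnertonDyer.Rank1Residual.Additive.GordRankZeroChiBranch
import HarnessLib

/-!
# T-O7 step 2: the ANALYTIC missing Prop of the cyclotomic rank-one route on the defect-2 rows, typed
# in the tree's own objects — `p`-adic Gross–Zagier on the quadratic branch of the good ordinary twist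
# (`BranchPAdicGrossZagierAt`) — PROVED in rank 0 (Birch–Pal), and in rank 1 the FACTORISATION
# `ChiBranchLowerDivisibilityAt ∧ BranchPAdicGrossZagierAt ⟹ CycLowerBoundAt`
# (cell `b2b-bsdres`, team n1011, seat p01, OWNERS row T-O7; the lead's R3-13(a) / R4-10 item
# "`DisegniDelbourgoComparisonAt`", route planner r3's ROUTE-r3 §4 S3)

HONEST FRAMING (cell `b2b-bsdres`, run/shared/lean/b2b/bsd-rank1-residual/, verbatim in every
file): prove what is provable now; shrink each hard class to its core with data; no claim beyond
stated classes. Research routes; census output = EVIDENCE / conjecture items, never a Literature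
fact; RESIDUAL-MAP marks change only by signed lines. §I O7 stays OPEN; X4♯(G-ord) stays
CONSTRUCTION-SHAPED; nothing is booked; no label changes. COVERAGE (stated first, referee 1
proviso): the DEFECT-2 rows `E = V ⊗ χ_p` with `V = E♭` GOOD ORDINARY at `p` and `p ≡ 1 (mod 4)`
(the even branch `ω^{(p−1)/2}`, `p* = p`; the odd-branch twin `p ≡ 3 (mod 4)` and the multiplicative-
twist rows (M) are the same construction on `padicLFunctionMinusBranch` / `…BranchMult` and are NOT
in this file); the class corollary additionally needs `p ≥ 5`, `E` non-CM, non-anomalous (A175). ONE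
definition (a typed input, `@[conjecture]`, nothing asserted — but PROVED in analytic rank `0`, §1) and
theorems; no Literature fact minted, no `_holds`.

## What and why

The lead (R3-13(a), R4-10) and r3 (ROUTE-r3 §4 S3) name ONE analytic missing Prop for the cyclotomic
rank-one route on O7-ord: `DisegniDelbourgoComparisonAt` — "Disegni's `L_{p,α}(σ_{E,K})` restricted
to the cyclotomic line = const · `L_p^{Del}(E) · L_p^{Del}(E^K)`", composed with Disegni 2017 Thm. B and
Gross–Zagier. Neither Delbourgo's measure nor Disegni's function is a tree object, so that Prop cannot
be typed non-vacuously today (p01, INBOX 2026-08-21T05:58Z). But on the DEFECT-2 rows Delbourgo's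
function IS, by construction (Compositio 113 Thm. 1, `d = 2`), the quadratic branch of the
Mazur–Tate–Teitelbaum measure of the good ordinary twist `V = E♭` — and THAT object is in the tree:
`padicLFunctionBranch f α (p/2)` (with `constantCoeff_padicLFunctionBranch_half`:
`B(0) = α⁻¹ · ∑_{a mod p} (a/p)[a/p]⁺_f`, MTT §I.14). So the analytic missing statement of the route
has an honest tree form:

* `BranchPAdicGrossZagierAt W p Dh` (§0, TYPED): for every good ordinary `V` with `C • V^{(p)} = W`,
  newform `f` of `V`, period ratio `ϖ` (`ϖ · Ω_V = Ω⁺_f`): writing `B = L_p(f, α, ω^{(p−1)/2}, T)` and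
  `r = rank_ℤ E(ℚ)`, `L^{(r)}(E,1)/r! = q · Ω_E · Reg_∞(E)` with `q ∈ ℚ` and
  **`ϖ · [T^r] B · log_p(γ_cyc)^r = u · q · Reg_p(E, Dh)`, `u ∈ ℤ_p^×`** — the shape of Perrin-Riou's
  theorem at a good ordinary prime (tree fact `perrinRiou_rankOne_leadingTerms`:
  `[T¹]L_p · log_p γ = q (1−α⁻¹)² Reg_p`) transplanted to the branch `ω^{(p−1)/2}` of the twist, i.e.
  [`p`-adic Gross–Zagier at the additive prime] ∘ [the MTT-branch ↔ Delbourgo ↔ Disegni comparison]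
  ∘ [Gross–Zagier]; r3's S3 is its provenance. In rank `1` this is NOT in print (RESIDUAL-MAP §I
  O7-ord; ttrl PLAN X4-2: "no rank-1 numerical instance of BS-D(p)(ii) at an additive prime is
  printed anywhere") — it is exactly what the census experiment X4-2 measures (A′ = the branch
  derivative, C = `#Ш_an·∏c·Reg_p/#tors²`, with BSD); OPEN, nothing asserted.
* §1 **RANK 0: it is a THEOREM** (`branchPAdicGrossZagierAt_of_analyticRank_eq_zero`): Birch's formula
  for `L(E,1)` through the twist + Pal's period relation (tree theorem
  `entireLFunction_one_eq_of_twist`, Pal 2012 Thm. 3.2 as the named fact `hPal`) and MTT's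
  `B(0) = α⁻¹ ∑(a/p)[a/p]⁺` give `ϖ·B(0) = (±α⁻¹)·L(E,1)/Ω_E` — so the typed input is a genuinely
  rank-ONE object, consistent with the rank-0 theory by proof.
* §2 **RANK 1: the FACTORISATION** (`cycLowerBoundAt_of_chiBranchLower_of_branchPAdicGrossZagier`):
  the team's W-level Λ-adic lower input on the branch `ChiBranchLowerDivisibilityAt W p` (seat p07,
  `ChiBranchLowerInput.lean`; derived from p10's `E♭`-level conjecture `QuadraticBranchLowerDivisibilityAt`)
  AND `BranchPAdicGrossZagierAt W p Dh` IMPLY p01's uniform typed input `CycLowerBoundAt W p Dh`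
  (`GordCycLowerBound.lean`): `fE = h · ϖB` in `ℚ_p⟦T⟧`, `B(0) = 0` in analytic rank one (Birch–Pal:
  `L(E,1) = ±ϖ·∑·Ω_E = 0` forces `∑ = 0`), hence `[T¹] fE = h(0)·ϖ·[T¹]B` and
  `[T¹] fE · log_p γ = (h(0)·u) · q · Reg_p`, cofactor `h(0)·u ∈ ℤ_p`. So on the defect-2 rows the
  cyclotomic rank-one input SPLITS as [branch main conjecture ⊇] ∘ [branch `p`-adic Gross–Zagier],
  the second factor being the kernel form of the lead's `DisegniDelbourgoComparisonAt`.
* §3 class corollary on X4♯(G-ord) ∩ `I₀*`, `p ≡ 1 (mod 4)`, `p ≥ 5`, non-CM, non-anomalous, `r_an = 1`: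
  `MissingLowerBoundAt W p` from the two typed inputs + the Schneider rider, all other binders published
  (A175, Pal, GZK, modularity).

References: [Delbourgo1998] Thm. 1 (d = 2), Main Conjecture (p. 151), BS-D(p) (pp. 151–152);
[Delbourgo2002] Thm. (B) (p. 40); [Disegni2017] Thm. A, B (shape/provenance only); [PerrinRiou1987]
§1.4 (shape); [MazurTateTeitelbaum1986Invent] §I.13–I.14; [Pal2012] Thm. 3.2; [Miller2011LMS] Def. 1.1.
-/

noncomputable section

open scoped Classical MatrixGroups ModularForm NumberField

open CongruenceSubgroup WeierstrassCurve NumberField Literature.NumberTheory.EllipticCurves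
  Literature.NumberTheory.EllipticCurves.ModularForms
  Literature.NumberTheory.EllipticCurves.Rank1Residual
  Literature.NumberTheory.EllipticCurves.Rank1Residual.Typed
  Literature.NumberTheory.EllipticCurves.Delbourgo2002
  IsDedekindDomain

namespace Summit.BirchSwinnertonDyer.Rank1Residual.Additive

/-! ### §0 The typed analytic input: `p`-adic Gross–Zagier on the quadratic branch (even branch) -/

/-- **TYPED INPUT — `p`-adic Gross–Zagier on the quadratic branch at an additive prime of defect 2
(even branch, `p ≡ 1 (mod 4)`; nothing asserted).** For `W = E` and a `p`-adic height datum `Dh` on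
`E(ℚ)`: for every globally minimal `V` GOOD ORDINARY at `p` with `C • V^{(p)} = W`, every newform `f` of
`V` and every `ϖ ∈ ℚ` with `ϖ · Ω_V = Ω⁺_f`, writing `B = padicLFunctionBranch f α (p/2)` (the
`ω^{(p−1)/2}`-branch of the Mazur–Tate–Teitelbaum measure of `f`, `α = unitRoot V p`) and
`r = rank_ℤ E(ℚ)`: `L^{(r)}(E,1)/r! = q · Ω_E · Reg_∞(E)` for a rational `q`, and
`ϖ · [T^r] B · log_p(γ_cyc)^r = u · q · Reg_p(E, Dh)` for a unit `u ∈ ℤ_p^×`. Rank `0`: a THEOREM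
(§1, Birch–Pal–MTT). Rank `1`: OPEN — the tree form of "`p`-adic Gross–Zagier at the additive prime ∘
(MTT-branch = Delbourgo = Disegni|_cyc comparison) ∘ Gross–Zagier" (r3 ROUTE-r3 §4 S3; RESIDUAL-MAP
§I O7-ord; measured by the census experiment X4-2). A predicate on `(W, p, Dh)`.
[cite: Delbourgo1998, Thm. 1 and §2.5 BS-D(p) (ii) (pp. 151–152) (shape only; nothing asserted)]
[cite: PerrinRiou1987, §1.4 (shape only)] [cite: MazurTateTeitelbaum1986Invent, §I.14] -/
@[conjecture] def BranchPAdicGrossZagierAt (W : WeierstrassCurve ℚ) [W.IsElliptic] (p : ℕ)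
    [Fact p.Prime] (Dh : PAdicHeightData W p) : Prop :=
  ∀ (V : WeierstrassCurve ℚ) [V.IsElliptic] [V.IsGloballyMinimal] {N : ℕ} [NeZero N]
    {f : CuspForm (Gamma0 N) 2},
    p % 4 = 1 → (∃ C : VariableChange ℚ, C • V.quadraticTwist (p : ℚ) = W) → GoodOrd V p →
    IsNewformOf V f → ∀ (ϖ : ℚ), (ϖ : ℝ) * V.realPeriodRat = plusPeriod f →
      ∃ (u : ℤ_[p]ˣ) (q : ℚ),
        W.leadingLCoeff = (q : ℂ) * (W.realPeriodRat : ℂ) * (W.regulator : ℂ) ∧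
        ((ϖ : ℚ) : ℚ_[p]) *
            PowerSeries.coeff W.mordellWeilRank
              (padicLFunctionBranch f ((unitRoot V p : ℤ_[p]) : ℚ_[p]) (p / 2)) *
            padicLog p (cyclotomicGenerator p) ^ W.mordellWeilRank =
          ((u : ℤ_[p]) : ℚ_[p]) * (q : ℚ_[p]) * padicRegulator Dh

variable (W : WeierstrassCurve ℚ) [W.IsElliptic] [W.IsGloballyMinimal] (p : ℕ) [hp : Fact p.Prime]

/-! ### §1 Rank 0: the typed input is a THEOREM (Birch–Pal–MTT) -/

/-- **Rank 0: `BranchPAdicGrossZagierAt W p Dh` HOLDS, for every height datum.** For `W` globally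
minimal, additive at `p ≡ 1 (mod 4)`, of analytic rank `0`: for every admissible `(V, C, f, ϖ)`,
`ϖ · B(0) = ϖ · α⁻¹ · ∑(a/p)[a/p]⁺_f` (`constantCoeff_padicLFunctionBranch_half`) and
`L(E,1) = ε · ϖ · ∑(a/p)[a/p]⁺_f · Ω_E`, `ε = ±1` (`entireLFunction_one_eq_of_twist`: Birch + Pal 2012
Thm. 3.2 `hPal` + modularity `hmod`); with `Reg_∞ = Reg_p = 1` and `L^{(0)} = L(E,1)` this is the
typed identity with `u = ε · α⁻¹ ∈ ℤ_p^×`. [cite: Pal2012, Thm. 3.2] [cite: MazurTateTeitelbaum1986Invent, §I.14] -/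
theorem branchPAdicGrossZagierAt_of_analyticRank_eq_zero
    (hPal : Pal2012.thm32_sqrt_mul_realPeriodRat_twist_eq_of_prime_one_mod_four)
    (hmod : hasEntireLFunction_rat) (hGZK : rank_eq_analyticRank_of_analyticRank_le_one)
    (hadd : Addv W p) (hr : W.analyticRank = 0) (Dh : PAdicHeightData W p) :
    BranchPAdicGrossZagierAt W p Dh := by
  intro V _ _ N _ f hp4 hVW hord hf ϖ hϖ
  have hpP : p.Prime := hp.out
  have hp2 : p ≠ 2 := by omega
  -- rank 0 bookkeeping
  obtain ⟨hmw, -⟩ := hGZK W (by rw [hr]; exact zero_le_one)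
  have hmw0 : W.mordellWeilRank = 0 := by rw [hmw, hr]
  haveI : Finite W.toAffine.Point := W.finite_point_of_rank_zero hmw0
  have hRegp : padicRegulator Dh = 1 := padicRegulator_eq_one_of_finite W p Dh
  have hReg : W.regulator = 1 := W.regulator_eq_one_of_rank_zero hmw0
  have hlead : W.leadingLCoeff = W.entireLFunction 1 := W.leadingLCoeff_eq_of_analyticRank_eq_zero hr
  -- Birch + Pal: `L(E,1) = ε ϖ S Ω_E`
  obtain ⟨ε, hε, hL⟩ := entireLFunction_one_eq_of_twist p hPal hmod hp4 V W hVW (Or.inl hord.1) hadd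
    hf ϖ hϖ
  -- MTT: `B(0) = α⁻¹ S`
  have hordin : IsOrdinaryAt V p := ⟨hord.1, hord.2⟩
  have hB0 := constantCoeff_padicLFunctionBranch_half p hp2 V hordin hf
  -- the unit `u = ε α⁻¹`
  have hαunit : IsUnit (unitRoot V p) := (unitRoot_spec_holds V p hordin).2
  have hαinv : (((hαunit.unit⁻¹ : ℤ_[p]ˣ) : ℤ_[p]) : ℚ_[p]) = ((unitRoot V p : ℤ_[p]) : ℚ_[p])⁻¹ := by
    have h2 : ((hαunit.unit⁻¹ : ℤ_[p]ˣ) : ℤ_[p]) * unitRoot V p = 1 := by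
      have h1 := hαunit.unit.inv_mul
      rwa [IsUnit.unit_spec] at h1
    have h : (((hαunit.unit⁻¹ : ℤ_[p]ˣ) : ℤ_[p]) : ℚ_[p]) * ((unitRoot V p : ℤ_[p]) : ℚ_[p]) = 1 := by
      rw [← PadicInt.coe_mul, h2, PadicInt.coe_one]
    exact eq_inv_of_mul_eq_one_left h
  -- the value side, common to both signs: `ϖ · B(0) = α⁻¹ · (ϖ S)`
  have hval : ((ϖ : ℚ) : ℚ_[p]) *
      PowerSeries.coeff W.mordellWeilRank
        (padicLFunctionBranch f ((unitRoot V p : ℤ_[p]) : ℚ_[p]) (p / 2)) *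
      padicLog p (cyclotomicGenerator p) ^ W.mordellWeilRank =
      ((unitRoot V p : ℤ_[p]) : ℚ_[p])⁻¹ * (((ϖ * legendrePlusSymbolSum f p : ℚ)) : ℚ_[p]) := by
    rw [hmw0, pow_zero, mul_one, PowerSeries.coeff_zero_eq_constantCoeff, hB0]
    push_cast
    ring
  rcases hε with rfl | rfl
  · refine ⟨hαunit.unit⁻¹, 1 * (ϖ * legendrePlusSymbolSum f p), ?_, ?_⟩
    · rw [hlead, hL, hReg]
      push_cast
      ring
    · rw [hval, hαinv, hRegp, one_mul, mul_one]
  · refine ⟨-hαunit.unit⁻¹, -1 * (ϖ * legendrePlusSymbolSum f p), ?_, ?_⟩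
    · rw [hlead, hL, hReg]
      push_cast
      ring
    · rw [hval, hRegp, mul_one, Units.val_neg, PadicInt.coe_neg, hαinv]
      push_cast
      ring

/-! ### §2 Rank 1: the factorisation `ChiBranchLower ∧ BranchPAdicGZ ⟹ CycLowerBound` -/

/-- **In analytic rank one the branch series vanishes at `T = 0`** (defect 2, `p ≡ 1 (mod 4)`): `B(0) =
α⁻¹·∑(a/p)[a/p]⁺_f` and `L(E,1) = ±ϖ·∑·Ω_E = 0` with `ϖ ≠ 0`, so `∑ = 0`.
[cite: MazurTateTeitelbaum1986Invent, §I.14] [cite: Pal2012, Thm. 3.2] -/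
theorem constantCoeff_branch_eq_zero_of_analyticRank_eq_one
    (hPal : Pal2012.thm32_sqrt_mul_realPeriodRat_twist_eq_of_prime_one_mod_four)
    (hmod : hasEntireLFunction_rat) (hadd : Addv W p) (hr : W.analyticRank = 1) (hp4 : p % 4 = 1)
    (V : WeierstrassCurve ℚ) [V.IsElliptic] [V.IsGloballyMinimal]
    (hVW : ∃ C : VariableChange ℚ, C • V.quadraticTwist (p : ℚ) = W) (hord : GoodOrd V p)
    {N : ℕ} [NeZero N] {f : CuspForm (Gamma0 N) 2} (hf : IsNewformOf V f)
    (ϖ : ℚ) (hϖ : (ϖ : ℝ) * V.realPeriodRat = plusPeriod f) :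
    PowerSeries.constantCoeff (padicLFunctionBranch f ((unitRoot V p : ℤ_[p]) : ℚ_[p]) (p / 2)) = 0 := by
  have hp2 : p ≠ 2 := by omega
  have hordin : IsOrdinaryAt V p := ⟨hord.1, hord.2⟩
  obtain ⟨ε, hε, hL⟩ := entireLFunction_one_eq_of_twist p hPal hmod hp4 V W hVW (Or.inl hord.1) hadd
    hf ϖ hϖ
  have hL0 : W.entireLFunction 1 = 0 := entireLFunction_one_eq_zero_of_analyticRank_eq_one hr
  have hΩ : (W.realPeriodRat : ℂ) ≠ 0 := by exact_mod_cast W.realPeriodRat_pos_holds.ne'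
  have hϖ0 : ϖ ≠ 0 := by
    rintro rfl
    have hper : 0 < plusPeriod f := IsNewform0.plusPeriod_pos_holds hf.1 hf.coeffField_eq_bot
    rw [← hϖ, Rat.cast_zero, zero_mul] at hper
    exact lt_irrefl _ hper
  have hε0 : ε ≠ 0 := by rcases hε with h | h <;> · rw [h]; norm_num
  have hS : legendrePlusSymbolSum f p = 0 := by
    rw [hL0] at hL
    have h := (mul_eq_zero.mp hL.symm).resolve_right hΩ
    have h' : (ε * (ϖ * legendrePlusSymbolSum f p) : ℚ) = 0 := by exact_mod_cast h
    simpa [hε0, hϖ0] using h'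
  rw [constantCoeff_padicLFunctionBranch_half p hp2 V hordin hf, hS, Rat.cast_zero, mul_zero]

omit [W.IsGloballyMinimal] in
/-- Coefficient bookkeeping: if `G(0) = 0` then `[T¹](H·G) = H(0)·[T¹]G` in `ℚ_p⟦T⟧`. [folklore] -/
theorem coeff_one_mul_of_constantCoeff_eq_zero (H G : PowerSeries ℚ_[p])
    (hG : PowerSeries.constantCoeff G = 0) :
    PowerSeries.coeff 1 (H * G) = PowerSeries.constantCoeff H * PowerSeries.coeff 1 G := by
  rw [PowerSeries.coeff_mul, Finset.Nat.antidiagonal_succ, Finset.sum_cons, Finset.Nat.antidiagonal_zero]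
  simp [hG]

/-- **RANK ONE: the FACTORISATION.** Let `W` be globally minimal, additive at `p ≡ 1 (mod 4)`, of
analytic rank `1`, `V` a globally minimal good ordinary curve with `C • V^{(p)} = W`, `f` its newform,
`ϖ·Ω_V = Ω⁺_f`. Then the W-level Λ-adic lower input on the branch `ChiBranchLowerDivisibilityAt W p`
(every `g ∈ char_Λ X(E/ℚ_∞)` is `h·(ϖ·B)` in `ℚ_p⟦T⟧`) and the typed `p`-adic Gross–Zagier
`BranchPAdicGrossZagierAt W p Dh` together give the uniform lower input `CycLowerBoundAt W p Dh`:
`[T¹]fE·log_p γ = (h(0)·u)·q·Reg_p(Dh)`. Published binders: Pal 2012 (`hPal`), modularity (`hmod`),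
GZK (`hGZK`, for `rank = 1`). [cite: Pal2012, Thm. 3.2] [cite: MazurTateTeitelbaum1986Invent, §I.14]
[cite: Delbourgo1998, §2.5 (p. 151) (shape)] -/
theorem cycLowerBoundAt_of_chiBranchLower_of_branchPAdicGrossZagier
    (hPal : Pal2012.thm32_sqrt_mul_realPeriodRat_twist_eq_of_prime_one_mod_four)
    (hmod : hasEntireLFunction_rat) (hGZK : rank_eq_analyticRank_of_analyticRank_le_one)
    (hadd : Addv W p) (hr : W.analyticRank = 1) (hp4 : p % 4 = 1)
    (V : WeierstrassCurve ℚ) [V.IsElliptic] [V.IsGloballyMinimal]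
    (hVW : ∃ C : VariableChange ℚ, C • V.quadraticTwist (p : ℚ) = W) (hord : GoodOrd V p)
    {N : ℕ} [NeZero N] {f : CuspForm (Gamma0 N) 2} (hf : IsNewformOf V f)
    (ϖ : ℚ) (hϖ : (ϖ : ℝ) * V.realPeriodRat = plusPeriod f)
    {Dh : PAdicHeightData W p} (hdiv : ChiBranchLowerDivisibilityAt W p)
    (hGZ : BranchPAdicGrossZagierAt W p Dh) : CycLowerBoundAt W p Dh := by
  intro κ γ hκ hγ hγ' D fE hchar
  have hmw : W.mordellWeilRank = 1 := by rw [(hGZK W (by rw [hr])).1, hr]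
  set B := padicLFunctionBranch f ((unitRoot V p : ℤ_[p]) : ℚ_[p]) (p / 2) with hB_def
  -- the Λ-adic lower input: `ι fE = ι h · (ϖ · B)`
  have hmem : fE ∈ D.charIdeal := by rw [hchar]; exact Ideal.mem_span_singleton_self fE
  obtain ⟨h, hfac⟩ := hdiv V hp4 hVW hord hκ hγ hγ' hf D ϖ hϖ fE hmem
  -- the typed `p`-adic Gross–Zagier
  obtain ⟨u, q, hlead, hpgz⟩ := hGZ V hp4 hVW hord hf ϖ hϖ
  rw [hmw, pow_one] at hpgz
  -- `B(0) = 0`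
  have hB0 : PowerSeries.constantCoeff B = 0 :=
    constantCoeff_branch_eq_zero_of_analyticRank_eq_one W p hPal hmod hadd hr hp4 V hVW hord hf ϖ hϖ
  -- `[T¹] fE = h(0) · ϖ · [T¹] B`
  have hcoeff : ((PowerSeries.coeff 1 fE : ℤ_[p]) : ℚ_[p]) =
      ((PowerSeries.constantCoeff h : ℤ_[p]) : ℚ_[p]) * (((ϖ : ℚ) : ℚ_[p]) * PowerSeries.coeff 1 B) := by
    have hϖB0 : PowerSeries.constantCoeff (PowerSeries.C ((ϖ : ℚ) : ℚ_[p]) * B) = 0 := by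
      rw [map_mul, hB0, mul_zero]
    rw [← Wuthrich2014.coeff_iwasawaToPowerSeries p fE 1, hfac,
      coeff_one_mul_of_constantCoeff_eq_zero p _ _ hϖB0, constantCoeff_iwasawaToPowerSeries,
      PowerSeries.coeff_C_mul]
  refine ⟨q, PowerSeries.constantCoeff h * (u : ℤ_[p]), hlead, ?_⟩
  rw [hmw, pow_one, hcoeff]
  push_cast
  calc ((PowerSeries.constantCoeff h : ℤ_[p]) : ℚ_[p]) * (((ϖ : ℚ) : ℚ_[p]) * PowerSeries.coeff 1 B) *
        padicLog p (cyclotomicGenerator p)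
      = ((PowerSeries.constantCoeff h : ℤ_[p]) : ℚ_[p]) *
          ((((ϖ : ℚ) : ℚ_[p]) * PowerSeries.coeff 1 B) * padicLog p (cyclotomicGenerator p)) := by ring
    _ = ((PowerSeries.constantCoeff h : ℤ_[p]) : ℚ_[p]) *
          (((u : ℤ_[p]) : ℚ_[p]) * (q : ℚ_[p]) * padicRegulator Dh) := by rw [hpgz]
    _ = ((PowerSeries.constantCoeff h : ℤ_[p]) : ℚ_[p]) * ((u : ℤ_[p]) : ℚ_[p]) * (q : ℚ_[p]) *
          padicRegulator Dh := by ring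

/-! ### §3 Class corollary: X4♯(G-ord) ∩ I₀*, `p ≡ 1 (mod 4)`, `p ≥ 5`, rank one -/

variable {W p} in
/-- **X4♯(G-ord) ∩ `I₀*`, `p ≡ 1 (mod 4)`, `p ≥ 5`, non-CM, non-anomalous, `r_an = 1`: the LOWER half
from the TWO typed inputs of the route** — the Λ-adic branch lower input `ChiBranchLowerDivisibilityAt W p`
and, for every height datum with Delbourgo's (B)-clauses, the Schneider rider (EVIDENCE binder) and
the branch `p`-adic Gross–Zagier `BranchPAdicGrossZagierAt W p Dh` — all other binders PUBLISHED:
Delbourgo 2002 (A)+(B) (`hDel`, A175), Pal 2012 (`hPal`), modularity (`hmod`, `hmodD`), GZK. The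
semistable-twist datum `(V, C, f, ϖ)` is DISCHARGED (`ClassX4Gord.exists_goodOrd_pStar_twist_model`,
`hmodD`). [cite: Delbourgo2002, Theorem (A), (B) (p. 40)] [cite: Pal2012, Thm. 3.2] [cite: Miller2011LMS, Def. 1.1] -/
theorem ClassX4Gord.missingLowerBoundAt_rankOne_of_chiBranchLower_of_branchPAdicGrossZagier
    (hDel : Delbourgo2002.mainTheorem)
    (hPal : Pal2012.thm32_sqrt_mul_realPeriodRat_twist_eq_of_prime_one_mod_four)
    (hmod : hasEntireLFunction_rat) (hmodD : nonempty_modularParametrizationData)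
    (hGZK : rank_eq_analyticRank_of_analyticRank_le_one)
    (hX : ClassX4Gord W p) (he : semistabilityIndex W p = 2) (hp4 : p % 4 = 1) (hp5 : 5 ≤ p)
    (hcm : ¬ W.HasCM) (hna : ReductionNonAnomalous W p) (hr : W.analyticRank = 1)
    (hdiv : ChiBranchLowerDivisibilityAt W p)
    (hGZ : ∀ Dh : PAdicHeightData W p, LeadingTermClauses W p Dh →
      SchneiderConjecture Dh ∧ BranchPAdicGrossZagierAt W p Dh) :
    MissingLowerBoundAt W p := by
  obtain ⟨V, iV, iVm, C, hV, hC⟩ := hX.exists_goodOrd_pStar_twist_model W p he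
  haveI : NeZero (V.conductorNorm ℤ) := ⟨(V.conductorNorm_pos_holds).ne'⟩
  obtain ⟨Dm⟩ := hmodD V
  obtain ⟨ϖ, -, hϖ, -⟩ := Dm.exists_rat_mul_realPeriodRat_eq_plusPeriod
  have hps : ((-1 : ℚ) ^ (p / 2) * (p : ℚ)) = (p : ℚ) := by
    have heven : Even (p / 2) := ⟨p / 4, by omega⟩
    rw [heven.neg_one_pow, one_mul]
  have hVW : ∃ C : VariableChange ℚ, C • V.quadraticTwist (p : ℚ) = W := ⟨C, by rw [← hps]; exact hC⟩
  refine missingLowerBoundAt_of_delbourgo2002_of_cycLowerBound W p hDel hGZK hp5 hcm hX.1.2.1 hX.2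
    (by rw [hr]) hna fun Dh hB ↦ ?_
  obtain ⟨hS, hGZDh⟩ := hGZ Dh hB
  exact ⟨hS, cycLowerBoundAt_of_chiBranchLower_of_branchPAdicGrossZagier W p hPal hmod hGZK hX.1.2.1 hr
    hp4 V hVW hV Dm.isNewformOf ϖ hϖ hdiv hGZDh⟩

end Summit.BirchSwinnertonDyer.Rank1Residual.Additive

end
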